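import Literature.MathematicalPhysics.StatisticalMechanics.HcpFccLatticeSums

/-!
# Certified hcp/fcc lattice sums: the forms and the soundness of the kernel evaluator

Part of the certified comparison `e_hcp < e_fcc` for Lennard-Jones (`LennardJonesHcpBelowFcc.lean`;
vocabulary in `HcpFccLatticeSums.lean`).  This file proves the elementary facts about the pattern
forms `Q_δ` (`Q₀ ≥ 1` off the origin, `Q₁ = (i + j/2 + 1/2)² + (3/4)(j + 1/3)² ≥ 1/12`,
nonnegativity, positivity of `Q_δ + k² t`) and the SOUNDNESS OF THE INTEGER EVALUATOR: at
`c² = p/q` the layer term is `(3q)ⁿ / latticeNumⁿ` with a positive integer numerator, the structural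
loops are `Finset.range` sums over the shifted square `[-R, R]²`, and `⌊M/Nⁿ⌋ ≤ M/Nⁿ < ⌊M/Nⁿ⌋ + 1`;
hence the CERTIFIED BOUNDS
`(3q)ⁿ · boxFloorSum / M ≤ ∑_{box R} layerTerm δ n (k² p/q) ≤ (3q)ⁿ (boxFloorSum + (2R+1)²) / M`
(`boxFloorSum_sound_le`, `boxFloorSum_sound_ge`; the upper one for `k ≠ 0 ∨ δ = 0`, `n ≠ 0`).
All statements are [folklore] numerics bookkeeping (same scheme as the tree's certified hcp sums of
crux `CoarseGrains`, there over cubes of `ℤ³`).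
-/

noncomputable section

namespace Literature.MathematicalPhysics.StatisticalMechanics.StackingSums

open Finset

/-! ## The forms -/

/-- `Q₀ = i² + ij + j² ≥ 1` off the origin (an integer). [folklore] -/
theorem one_le_stackForm_zero {i j : ℤ} (h : (i, j) ≠ (0, 0)) : (1 : ℝ) ≤ stackForm 0 i j := by
  have hz : 1 ≤ i ^ 2 + i * j + j ^ 2 := by
    by_cases hj : j = 0
    · subst hj
      have hi : i ≠ 0 := by rintro rfl; exact h rfl
      have : 0 < i ^ 2 := by positivity
      nlinarith
    · have h1 : 0 < j ^ 2 := by positivity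
      nlinarith [sq_nonneg (2 * i + j)]
  rw [stackForm_zero]
  exact_mod_cast hz

/-- `Q₀ ≥ 0`. [folklore] -/
theorem stackForm_zero_nonneg (i j : ℤ) : 0 ≤ stackForm 0 i j := by
  rw [stackForm_zero]; nlinarith [sq_nonneg ((i : ℝ) + j), sq_nonneg ((i : ℝ) - j)]

/-- `Q₁ = (i + j/2 + 1/2)² + (3/4)(j + 1/3)²`. [folklore] -/
theorem stackForm_one_eq_sq (i j : ℤ) :
    stackForm 1 i j = ((i : ℝ) + j / 2 + 1 / 2) ^ 2 + 3 / 4 * ((j : ℝ) + 1 / 3) ^ 2 := by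
  rw [stackForm_one]; ring

/-- `Q₁ ≥ 1/12 > 0` (`j + 1/3` is at least `1/3` in absolute value). [folklore] -/
theorem stackForm_one_pos (i j : ℤ) : 1 / 12 ≤ stackForm 1 i j := by
  rw [stackForm_one_eq_sq]
  have hj : (1 : ℝ) / 9 ≤ ((j : ℝ) + 1 / 3) ^ 2 := by
    rcases le_or_gt 0 j with h | h
    · have : (0 : ℝ) ≤ j := by exact_mod_cast h
      nlinarith
    · have : (j : ℝ) ≤ -1 := by exact_mod_cast (show j ≤ -1 by omega)
      nlinarith
  nlinarith [sq_nonneg ((i : ℝ) + j / 2 + 1 / 2)]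

/-- The forms are nonnegative for `δ ≤ 1`. [folklore] -/
theorem stackForm_nonneg {δ : ℕ} (hδ : δ ≤ 1) (i j : ℤ) : 0 ≤ stackForm δ i j := by
  interval_cases δ
  · exact stackForm_zero_nonneg i j
  · linarith [stackForm_one_pos i j]

/-- **Positivity of the squared norms**: `stackForm δ i j + s > 0` unless `δ = 0`, `s = 0` and
`(i,j) = 0`; here in the form used by the evaluator (`s = k² t`, `t > 0`). [folklore] -/
theorem stackForm_add_pos {δ : ℕ} (hδ : δ ≤ 1) {t : ℝ} (ht : 0 < t) {k i j : ℤ}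
    (h : k ≠ 0 ∨ (i, j) ≠ (0, 0) ∨ δ = 1) : 0 < stackForm δ i j + (k : ℝ) ^ 2 * t := by
  have h0 := stackForm_nonneg hδ i j
  have hk2 : 0 ≤ (k : ℝ) ^ 2 * t := by positivity
  rcases h with hk | hij | rfl
  · have : (0 : ℝ) < (k : ℝ) ^ 2 * t := by
      have : (k : ℝ) ≠ 0 := by exact_mod_cast hk
      positivity
    linarith
  · interval_cases δ
    · linarith [one_le_stackForm_zero hij]
    · linarith [stackForm_one_pos i j]
  · linarith [stackForm_one_pos i j]

/-- The layer terms are nonnegative (`δ ≤ 1`, `s ≥ 0`). [folklore] -/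
theorem layerTerm_nonneg {δ : ℕ} (hδ : δ ≤ 1) (n : ℕ) {s : ℝ} (hs : 0 ≤ s) (ij : ℤ × ℤ) :
    0 ≤ layerTerm δ n s ij := by
  unfold layerTerm
  have := stackForm_nonneg hδ ij.1 ij.2
  positivity

/-! ## The integer evaluator: soundness -/

/-- The integer numerator is `3q · Q_δ + 3 p k²`. [folklore] -/
theorem latticeNum_cast (p q δ : ℕ) (k i j : ℤ) :
    (latticeNum p q δ k i j : ℝ) = 3 * (q : ℝ) * stackForm δ i j + 3 * (p : ℝ) * (k : ℝ) ^ 2 := by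
  unfold latticeNum stackForm
  push_cast
  ring

/-- For `c² = p/q`: `Q_δ + k² c² = latticeNum / (3q)`. [folklore] -/
theorem stackForm_add_eq_latticeNum_div (p : ℕ) {q : ℕ} (hq : 0 < q) (δ : ℕ) (k i j : ℤ) :
    stackForm δ i j + (k : ℝ) ^ 2 * ((p : ℝ) / q) = (latticeNum p q δ k i j : ℝ) / (3 * (q : ℝ)) := by
  have hq' : (q : ℝ) ≠ 0 := by positivity
  rw [latticeNum_cast]
  field_simp

/-- The numerator is positive off the omitted site. [folklore] -/
theorem latticeNum_pos {p q δ : ℕ} (hp : 0 < p) (hq : 0 < q) (hδ : δ ≤ 1) {k i j : ℤ}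
    (h : k ≠ 0 ∨ (i, j) ≠ (0, 0) ∨ δ = 1) : 0 < latticeNum p q δ k i j := by
  have hpos := stackForm_add_pos hδ (t := (p : ℝ) / q) (by positivity) h
  rw [stackForm_add_eq_latticeNum_div p hq] at hpos
  have h3 : (0 : ℝ) < 3 * (q : ℝ) := by positivity
  have h' : (0 : ℝ) < (latticeNum p q δ k i j : ℝ) := by
    by_contra hcon
    push Not at hcon
    have := div_nonpos_of_nonpos_of_nonneg hcon h3.le
    linarith
  exact_mod_cast h'

/-- The layer term at `c² = p/q` through the numerator. [folklore] -/
theorem layerTerm_eq_of_rat (p : ℕ) {q : ℕ} (hq : 0 < q) (δ n : ℕ) (k : ℤ) (ij : ℤ × ℤ) :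
    layerTerm δ n ((k : ℝ) ^ 2 * ((p : ℝ) / q)) ij =
      (3 * (q : ℝ)) ^ n * ((latticeNum p q δ k ij.1 ij.2 : ℝ)⁻¹) ^ n := by
  unfold layerTerm
  rw [stackForm_add_eq_latticeNum_div p hq, inv_div, div_eq_mul_inv, mul_pow]

/-- Upper floor bound for one term: `floor ≤ target`. [folklore] -/
theorem boxFloorTerm_le {p q δ : ℕ} (hp : 0 < p) (hq : 0 < q) (hδ : δ ≤ 1) (k R n M ii jj : ℕ) :
    (boxFloorTerm p q δ k R n M ii jj : ℝ) ≤ boxTarget p q δ k R n M ii jj := by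
  unfold boxFloorTerm boxTarget
  by_cases h0 : k = 0 ∧ ii = R ∧ jj = R
  · rw [if_pos h0, if_pos h0]; simp
  · rw [if_neg h0, if_neg h0]
    have hv : (k : ℤ) ≠ 0 ∨ (((ii : ℤ) - R, (jj : ℤ) - R) : ℤ × ℤ) ≠ (0, 0) ∨ δ = 1 := by
      by_cases hk : k = 0
      · right; left
        intro h
        simp only [Prod.mk.injEq, sub_eq_zero] at h
        omega
      · left; exact_mod_cast hk
    have hN := latticeNum_pos hp hq hδ hv
    set N := latticeNum p q δ k ((ii : ℤ) - R) ((jj : ℤ) - R) with hNdef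
    have hNc : ((N.toNat : ℕ) : ℝ) = (N : ℝ) := by
      have : ((N.toNat : ℕ) : ℤ) = N := Int.toNat_of_nonneg hN.le
      exact_mod_cast this
    have hd : (0 : ℝ) < (N : ℝ) ^ n := by
      have : (0 : ℝ) < (N : ℝ) := by exact_mod_cast hN
      positivity
    calc ((M / N.toNat ^ n : ℕ) : ℝ) ≤ (M : ℝ) / ((N.toNat ^ n : ℕ) : ℝ) := Nat.cast_div_le
      _ = M * ((N : ℝ)⁻¹) ^ n := by rw [Nat.cast_pow, hNc, inv_pow, div_eq_mul_inv]

/-- Lower floor bound for one term: `target ≤ floor + 1`. [folklore] -/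
theorem boxTarget_le_boxFloorTerm_add_one {p q δ : ℕ} (hp : 0 < p) (hq : 0 < q) (hδ : δ ≤ 1)
    (k R n M ii jj : ℕ) :
    boxTarget p q δ k R n M ii jj ≤ (boxFloorTerm p q δ k R n M ii jj : ℝ) + 1 := by
  unfold boxFloorTerm boxTarget
  by_cases h0 : k = 0 ∧ ii = R ∧ jj = R
  · rw [if_pos h0, if_pos h0]; simp
  · rw [if_neg h0, if_neg h0]
    have hv : (k : ℤ) ≠ 0 ∨ (((ii : ℤ) - R, (jj : ℤ) - R) : ℤ × ℤ) ≠ (0, 0) ∨ δ = 1 := by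
      by_cases hk : k = 0
      · right; left
        intro h
        simp only [Prod.mk.injEq, sub_eq_zero] at h
        omega
      · left; exact_mod_cast hk
    have hN := latticeNum_pos hp hq hδ hv
    set N := latticeNum p q δ k ((ii : ℤ) - R) ((jj : ℤ) - R) with hNdef
    have hNc : ((N.toNat : ℕ) : ℝ) = (N : ℝ) := by
      have : ((N.toNat : ℕ) : ℤ) = N := Int.toNat_of_nonneg hN.le
      exact_mod_cast this
    have hNpos : (0 : ℝ) < (N : ℝ) := by exact_mod_cast hN
    set d : ℕ := N.toNat ^ n with hddef
    have hdc : (d : ℝ) = (N : ℝ) ^ n := by rw [hddef, Nat.cast_pow, hNc]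
    have hdpos : (0 : ℝ) < d := by rw [hdc]; positivity
    have hdiv := Nat.div_add_mod M d
    have hmod := Nat.mod_lt M (show 0 < d by exact_mod_cast hdpos)
    have hreal : (M : ℝ) < (d : ℝ) * ((M / d : ℕ) : ℝ) + d := by
      have : (M : ℝ) = (d : ℝ) * ((M / d : ℕ) : ℝ) + ((M % d : ℕ) : ℝ) := by exact_mod_cast hdiv.symm
      have h2 : ((M % d : ℕ) : ℝ) < d := by exact_mod_cast hmod
      linarith
    have key : (M : ℝ) * ((N : ℝ)⁻¹) ^ n = (M : ℝ) / d := by rw [hdc, inv_pow, div_eq_mul_inv]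
    rw [key, div_le_iff₀ hdpos]
    nlinarith

/-- The inner loop is a `Finset.range` sum. [folklore] -/
theorem boxLoopJ_eq (p q δ k R n M ii m : ℕ) :
    boxLoopJ p q δ k R n M ii m = ∑ jj ∈ range m, boxFloorTerm p q δ k R n M ii jj := by
  induction m with
  | zero => rfl
  | succ m ih => rw [boxLoopJ, ih, sum_range_succ]

/-- The outer loop is a `Finset.range` sum. [folklore] -/
theorem boxLoopI_eq (p q δ k R n M m : ℕ) :
    boxLoopI p q δ k R n M m =
      ∑ ii ∈ range m, ∑ jj ∈ range (2 * R + 1), boxFloorTerm p q δ k R n M ii jj := by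
  induction m with
  | zero => rfl
  | succ m ih => rw [boxLoopI, ih, sum_range_succ, boxLoopJ_eq]

/-- The floor sum as a double `Finset.range` sum. [folklore] -/
theorem boxFloorSum_eq (p q δ k R n M : ℕ) :
    boxFloorSum p q δ k R n M =
      ∑ ii ∈ range (2 * R + 1), ∑ jj ∈ range (2 * R + 1), boxFloorTerm p q δ k R n M ii jj :=
  boxLoopI_eq p q δ k R n M _

/-- `[-R, R] ⊆ ℤ` as the image of `range (2R+1)`. [folklore] -/
theorem Icc_neg_eq_image_range (R : ℕ) :
    Icc (-(R : ℤ)) R = (range (2 * R + 1)).image fun kk : ℕ => (kk : ℤ) - R := by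
  ext x
  simp only [mem_Icc, mem_image, mem_range]
  constructor
  · intro h
    exact ⟨(x + R).toNat, by omega, by omega⟩
  · rintro ⟨kk, hkk, rfl⟩
    omega

/-- Reindexing a sum over `[-R, R]` by `range (2R+1)`. [folklore] -/
theorem sum_Icc_neg_eq_sum_range (R : ℕ) (g : ℤ → ℝ) :
    ∑ i ∈ Icc (-(R : ℤ)) R, g i = ∑ ii ∈ range (2 * R + 1), g ((ii : ℤ) - R) := by
  rw [Icc_neg_eq_image_range, sum_image]
  intro a _ b _ h
  have : (a : ℤ) = b := by linarith
  exact_mod_cast this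

/-- **Reindexing the box sum** by the shifted natural indices. [folklore] -/
theorem sum_box_eq_sum_range (R : ℕ) (F : ℤ × ℤ → ℝ) :
    ∑ ij ∈ box R, F ij = ∑ ii ∈ range (2 * R + 1), ∑ jj ∈ range (2 * R + 1),
      F ((ii : ℤ) - R, (jj : ℤ) - R) := by
  unfold box
  rw [sum_product, sum_Icc_neg_eq_sum_range]
  refine sum_congr rfl fun ii _ => ?_
  rw [sum_Icc_neg_eq_sum_range]

/-- Membership in the box. [folklore] -/
theorem mem_box {R : ℕ} {ij : ℤ × ℤ} : ij ∈ box R ↔ |ij.1| ≤ R ∧ |ij.2| ≤ R := by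
  obtain ⟨i, j⟩ := ij
  simp only [box, mem_product, mem_Icc, abs_le]

/-- `#[-R,R]² = (2R+1)²`. [folklore] -/
theorem card_box (R : ℕ) : (box R).card = (2 * R + 1) ^ 2 := by
  simp only [box, card_product, Int.card_Icc]
  have : ((R : ℤ) + 1 - -(R : ℤ)).toNat = 2 * R + 1 := by omega
  rw [this]; ring

/-- The box part of the layer sum at `c² = p/q`, with the omitted site written out:
`∑_{box} [¬(k = 0 ∧ ij = 0)] layerTerm`.  For `k ≠ 0 ∨ δ = 0` the indicator is superfluous
(at `k = 0`, `δ = 0` the origin term is `0` by itself). [folklore] -/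
theorem sum_box_ite_eq (p : ℕ) {q : ℕ} (hq : 0 < q) (δ n : ℕ) (k : ℕ) (R M : ℕ) (hM : 0 < M) :
    ∑ ii ∈ range (2 * R + 1), ∑ jj ∈ range (2 * R + 1), boxTarget p q δ k R n M ii jj =
      (M : ℝ) / (3 * (q : ℝ)) ^ n * ∑ ij ∈ box R,
        (if (k : ℤ) = 0 ∧ ij = (0, 0) then 0 else layerTerm δ n ((k : ℝ) ^ 2 * ((p : ℝ) / q)) ij) := by
  rw [sum_box_eq_sum_range, mul_sum]
  refine sum_congr rfl fun ii _ => ?_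
  rw [mul_sum]
  refine sum_congr rfl fun jj _ => ?_
  unfold boxTarget
  have h3q : (3 * (q : ℝ)) ^ n ≠ 0 := by positivity
  by_cases h0 : k = 0 ∧ ii = R ∧ jj = R
  · have h0' : (k : ℤ) = 0 ∧ (((ii : ℤ) - R, (jj : ℤ) - R) : ℤ × ℤ) = (0, 0) := by
      refine ⟨by exact_mod_cast h0.1, ?_⟩
      simp only [Prod.mk.injEq]; omega
    rw [if_pos h0, if_pos h0', mul_zero]
  · have h0' : ¬ ((k : ℤ) = 0 ∧ (((ii : ℤ) - R, (jj : ℤ) - R) : ℤ × ℤ) = (0, 0)) := by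
      intro h
      simp only [Prod.mk.injEq] at h
      omega
    have hk : (((k : ℤ) : ℝ)) = (k : ℝ) := Int.cast_natCast k
    have hlt := layerTerm_eq_of_rat p hq δ n (k : ℤ) (((ii : ℤ) - R, (jj : ℤ) - R))
    rw [hk] at hlt
    rw [if_neg h0, if_neg h0', hlt]
    field_simp

/-- **Certified lower bound of the box part**: `(3q)ⁿ · FS / M ≤ ∑_{box R} layerTerm δ n (k² p/q)`
(`δ ≤ 1`). [folklore] -/
theorem boxFloorSum_sound_le {p q δ : ℕ} (hp : 0 < p) (hq : 0 < q) (hδ : δ ≤ 1) (k R n : ℕ)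
    {M : ℕ} (hM : 0 < M) :
    (3 * (q : ℝ)) ^ n * (boxFloorSum p q δ k R n M : ℝ) / M ≤
      ∑ ij ∈ box R, layerTerm δ n ((k : ℝ) ^ 2 * ((p : ℝ) / q)) ij := by
  have hfs : (boxFloorSum p q δ k R n M : ℝ) ≤
      ∑ ii ∈ range (2 * R + 1), ∑ jj ∈ range (2 * R + 1), boxTarget p q δ k R n M ii jj := by
    rw [boxFloorSum_eq]
    push_cast
    exact sum_le_sum fun ii _ => sum_le_sum fun jj _ => boxFloorTerm_le hp hq hδ k R n M ii jj
  rw [sum_box_ite_eq p hq δ n k R M hM] at hfs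
  have hle : ∑ ij ∈ box R, (if (k : ℤ) = 0 ∧ ij = (0, 0) then 0
      else layerTerm δ n ((k : ℝ) ^ 2 * ((p : ℝ) / q)) ij) ≤
      ∑ ij ∈ box R, layerTerm δ n ((k : ℝ) ^ 2 * ((p : ℝ) / q)) ij := by
    refine sum_le_sum fun ij _ => ?_
    split_ifs
    · exact layerTerm_nonneg hδ n (by positivity) ij
    · exact le_rfl
  have h3q : (0 : ℝ) < (3 * (q : ℝ)) ^ n := by positivity
  have hM' : (0 : ℝ) < M := by exact_mod_cast hM
  rw [div_le_iff₀ hM']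
  calc (3 * (q : ℝ)) ^ n * (boxFloorSum p q δ k R n M : ℝ)
      ≤ (3 * (q : ℝ)) ^ n * ((M : ℝ) / (3 * (q : ℝ)) ^ n * ∑ ij ∈ box R,
          (if (k : ℤ) = 0 ∧ ij = (0, 0) then 0
            else layerTerm δ n ((k : ℝ) ^ 2 * ((p : ℝ) / q)) ij)) :=
        mul_le_mul_of_nonneg_left hfs h3q.le
    _ = (∑ ij ∈ box R, (if (k : ℤ) = 0 ∧ ij = (0, 0) then 0
            else layerTerm δ n ((k : ℝ) ^ 2 * ((p : ℝ) / q)) ij)) * M := by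
        field_simp
    _ ≤ _ := mul_le_mul_of_nonneg_right hle hM'.le

/-- **Certified upper bound of the box part**: for `k ≠ 0 ∨ δ = 0`,
`∑_{box R} layerTerm δ n (k² p/q) ≤ (3q)ⁿ (FS + (2R+1)²) / M`. [folklore] -/
theorem boxFloorSum_sound_ge {p q δ : ℕ} (hp : 0 < p) (hq : 0 < q) (hδ : δ ≤ 1) {k : ℕ} (R : ℕ)
    {n : ℕ} (hn : n ≠ 0) (hk : k ≠ 0 ∨ δ = 0) {M : ℕ} (hM : 0 < M) :
    ∑ ij ∈ box R, layerTerm δ n ((k : ℝ) ^ 2 * ((p : ℝ) / q)) ij ≤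
      (3 * (q : ℝ)) ^ n * ((boxFloorSum p q δ k R n M : ℝ) + (2 * R + 1) ^ 2) / M := by
  have hcount : ((2 * R + 1 : ℕ) : ℝ) ^ 2 =
      ∑ _ii ∈ range (2 * R + 1), ∑ _jj ∈ range (2 * R + 1), (1 : ℝ) := by
    simp only [sum_const, card_range, nsmul_eq_mul, mul_one]
    push_cast; ring
  have hfs : ∑ ii ∈ range (2 * R + 1), ∑ jj ∈ range (2 * R + 1), boxTarget p q δ k R n M ii jj ≤
      (boxFloorSum p q δ k R n M : ℝ) + (2 * R + 1) ^ 2 := by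
    rw [boxFloorSum_eq]
    push_cast
    rw [show ((2 : ℝ) * R + 1) ^ 2 = ((2 * R + 1 : ℕ) : ℝ) ^ 2 by push_cast; ring, hcount,
      ← sum_add_distrib]
    refine sum_le_sum fun ii _ => ?_
    rw [← sum_add_distrib]
    exact sum_le_sum fun jj _ => boxTarget_le_boxFloorTerm_add_one hp hq hδ k R n M ii jj
  rw [sum_box_ite_eq p hq δ n k R M hM] at hfs
  have heq : ∑ ij ∈ box R, (if (k : ℤ) = 0 ∧ ij = (0, 0) then 0
      else layerTerm δ n ((k : ℝ) ^ 2 * ((p : ℝ) / q)) ij) =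
      ∑ ij ∈ box R, layerTerm δ n ((k : ℝ) ^ 2 * ((p : ℝ) / q)) ij := by
    refine sum_congr rfl fun ij _ => ?_
    split_ifs with h
    · obtain ⟨hk0, rfl⟩ := h
      have hk0' : k = 0 := by exact_mod_cast hk0
      rcases hk with hk | rfl
      · exact absurd hk0' hk
      · simp [layerTerm, hk0', hn]
    · rfl
  rw [heq] at hfs
  have h3q : (0 : ℝ) < (3 * (q : ℝ)) ^ n := by positivity
  have hM' : (0 : ℝ) < M := by exact_mod_cast hM
  rw [le_div_iff₀ hM']
  have := mul_le_mul_of_nonneg_left hfs h3q.le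
  have e1 : (3 * (q : ℝ)) ^ n * ((M : ℝ) / (3 * (q : ℝ)) ^ n *
      ∑ ij ∈ box R, layerTerm δ n ((k : ℝ) ^ 2 * ((p : ℝ) / q)) ij) =
      (∑ ij ∈ box R, layerTerm δ n ((k : ℝ) ^ 2 * ((p : ℝ) / q)) ij) * M := by
    field_simp
  linarith

end Literature.MathematicalPhysics.StatisticalMechanics.StackingSums

end
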